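import Literature.NumberTheory.EllipticCurves.EmertonPollackWeston2006.HidaFamilyTransfer
import HarnessLib

/-!
# Emerton–Pollack–Weston 2006, Theorem 1 (analytic half) with `p` IN THE LEVEL: `μ^an = 0` passes to an
# elliptic curve MULTIPLICATIVE at `p ≥ 5` from a mod-`p` congruent curve (good ordinary, or
# multiplicative) — two named facts

Topic `NumberTheory/EllipticCurves`, sub-directory `EmertonPollackWeston2006` (namespace = path). TWO
named facts (`def … : Prop`, D-0014, nothing asserted, no `_holds`); the bookkeeping (symmetry in the pair,
split-currency `IsSplitMultPAdicLFunctionOf f p L ↔ IsMultPAdicLFunctionOf f p 1 L`) is proved on the consumer side. Companion of `MuAnTransferGoodOrdinary.lean` (both curves GOOD ordinary; its module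
docstring records "`-- TODO(general form): … p in the level`") and of `HidaFamilyTransfer.lean`
(Cor. 5.1.4 / Thm. 5.1.3 = the MAIN-CONJECTURE transfer to a multiplicative curve, audited R33.4, whose
bridges — `H(ρ̄)` contains the `p`-new weight-two member, Ex. 5.3.1; canonical vs Néron period at
`p ‖ N` — are reused verbatim here). This file vendors ONLY the `μ^an`-clause of Theorem 1 for a target
curve with `p ‖ N`, which is what the BSD cell `bsd-stepL` consumes (crux `NonSurjCornerTwinMuAn`, item
stmt-BirchSwinnertonDyer-19948: the per-pair certificate `μ^an(E, p) = 0` at a multiplicative `p` is an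
invariant of the mod-`p` representation `E[p]`; written by its lane-B prover seat `bsd-stepL-corner5-p2`).
HONEST FRAMING: nothing here proves BSD for any curve; named facts are hypotheses consumers take by name.

## The printed statement (arXiv:math/0404484 = Invent. Math. 163 (2006) 523–580; held text
`paper:arxiv-math_0404484`, chunk∕line locators of that materialisation)

* Intro, chunk p0002 L3–L13: "Let `ρ̄ : G_ℚ → GL₂(k)` be an absolutely irreducible modular Galois
  representation over a finite field `k` of characteristic `p`. Assume further that `ρ̄` is `p`-ordinary
  and `p`-distinguished … The Hida family `H(ρ̄)` of `ρ̄` is the set of all `p`-ordinary `p`-stabilized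
  newforms `f` with mod `p` Galois representation isomorphic to `ρ̄`."
* **Theorem 1** (chunk p0002 L33–L37, verbatim): "Fix `∗ ∈ {alg, an}`. If `μ^∗(f₀) = 0` for some
  `f₀ ∈ H(ρ̄)`, then `μ^∗(f) = 0` for all `f ∈ H(ρ̄)`."
* §1 Notation (chunk p0005): "We fix an odd prime `p`"; §2.6 (chunk p0013): `p`-distinguished = the two
  diagonal characters of `ρ̄|_{G_p}` are distinct.
* `p` IN THE LEVEL — Example 5.3.1 (chunk p0032 L20–L60, verbatim): "Set `p = 11` and let `f` denote the
  weight `2` newform associated to the elliptic curve `X₀(11)` … for `k ≥ 2`, there is a unique newform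
  `f_k` of weight `k` and level dividing `11` that is congruent to `f` modulo `11` … Since `X₀(11)` has
  split multiplicative reduction at `p = 11`, the `p`-adic `L`-function `L_p^an(f,T)` has a trivial zero
  at `T = 0` … Thus `L_p^an(f,T)` is a unit multiple of `T` so that `λ^an(f) = 1` and `μ^an(f) = 0`."
  So the `p`-NEW weight-two newform of an elliptic curve with multiplicative reduction at `p` (tame level
  `N/p`, `U_p`-eigenvalue `a_p = ±1`, a unit) IS a member of `H(ρ̄)`, its `μ^an` being that of the
  Mazur–Tate–Teitelbaum function `L_p^an(f,T)` (the same reading as `cor514_transfer_of_goodOrdinary` /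
  `cor514_transfer_of_multiplicative` in `HidaFamilyTransfer.lean`).

## Transcription and bridges (weaker than print, never stronger)

`W₁, W₂/ℚ` globally minimal elliptic curves, `5 ≤ p` (print: odd `p`), a `Γ_ℚ`-equivariant additive
isomorphism `W₁[p] ≃ W₂[p]`, `W₁[p]` irreducible — so `ρ̄ := W₁[p] ≅ W₂[p]` is absolutely irreducible
(odd, irreducible, odd characteristic), modular, and `p`-ordinary `p`-distinguished at a good ORDINARY or
MULTIPLICATIVE `p` (the diagonal characters on `G_{ℚ_p}` are `δω`, `δ` with `δ` unramified, distinct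
since `ω ≠ 1` for `p ≥ 3`; Tate curve at `p ‖ N`). `W₂` is MULTIPLICATIVE at `p`
(`HasMultiplicativeReductionAtPrime`); `W₁` is good ordinary (`thm1_muAn_transfer_mult_of_goodOrdinary`)
or multiplicative (`thm1_muAn_transfer_mult_of_multiplicative`). The clause "`μ^an = 0`":
* at a GOOD ordinary curve — byte-identical to the hypothesis of `thm1_muAn_transfer_of_torsionIso`
  (`MuAnTransferGoodOrdinary.lean`): for every newform `f` of `W` at level `N_W` and every `ϖ ∈ ℚ` with
  `ϖ·Ω_W = Ω⁺_f`, some coefficient of `ϖ · padicLFunction f α` (`α` the unit root) is a `p`-adic unit;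
* at a MULTIPLICATIVE curve — byte-identical to the body of the BSD cell's typed certificate
  `Summit.BirchSwinnertonDyer.Rank1Residual.X11a.MuAnZeroAt` (file
  `Summits/BirchSwinnertonDyer/Rank1Residual/X11a/MuLambdaSplit.lean`) and to the `μ`-clause of
  `MultiplicativeCharIdealMuZero` (`HidaFamilyTransfer.lean`): for every newform `f` of `W` (any level
  `N`, `IsNewformOf W f`) and every `ϖ` with `ϖ·Ω_W = Ω⁺_f`, some coefficient of `ϖ·L` is a `p`-adic
  unit, for THE non-split Mazur–Tate–Teitelbaum function (`IsMultPAdicLFunctionOf f p (-1) L`) at a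
  non-split `p` and THE split one (`IsSplitMultPAdicLFunctionOf f p L`) at a split `p` (at a split `p`
  the trivial zero `T ∣ L` does not affect the `μ`-invariant).
EPW's `μ^an` is computed with a canonical period (Prop. 4.1.4, chunk p0021); for irreducible `E[p]` at an
odd `p` of good OR multiplicative reduction the canonical and Néron normalisations differ by a `p`-adic
unit — Greenberg–Vatsal, Invent. Math. 142 (2000) §3 Prop. (3.1) ("all odd primes `p` of either good or
multiplicative reduction"), Remark (3.4), Prop. (3.7); at `p ‖ N` also Skinner, Pacific J. Math. 283
(2016) §3.3 — the SAME bridge as the audited `cor514_transfer_of_goodOrdinary` (R33.4) and as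
`thm1_muAn_transfer_of_torsionIso`. Named facts; nothing asserted; users take
`(h : thm1_muAn_transfer_mult_of_multiplicative)` etc. No `_holds` (size XL: Hida theory for `ρ̄`,
two-variable `p`-adic `L`-functions, EPW §§2–4).

## References

* M. Emerton, R. Pollack, T. Weston, Invent. Math. 163 (2006) 523–580, Thm. 1 (p. 524 = arXiv p. 2),
  §1 (p. 5), §2.6, Prop. 4.1.4, Thm. 4.4.5, Ex. 5.3.1 (arXiv p. 32). [EmertonPollackWeston2006]
* R. Greenberg, V. Vatsal, Invent. Math. 142 (2000) 17–63, §3: Prop. (3.1), Remark (3.4), Prop. (3.7).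
  [GreenbergVatsal2000]
* C. Skinner, Pacific J. Math. 283 (2016) 171–200, §3.2–§3.3. [Skinner2016PacificMC]
-/

noncomputable section

open scoped Classical MatrixGroups ModularForm

open CongruenceSubgroup WeierstrassCurve Literature.NumberTheory.EllipticCurves
  Literature.NumberTheory.EllipticCurves.ModularForms Literature.NumberTheory.EllipticCurves.Rank1Residual
  Literature.NumberTheory.EllipticCurves.GreenbergVatsal2000

namespace Literature.NumberTheory.EllipticCurves.EmertonPollackWeston2006

/-- **Emerton–Pollack–Weston 2006, Theorem 1 (analytic half): from a GOOD-ordinary curve to a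
mod-`p` congruent curve MULTIPLICATIVE at `p`.** Invent. Math. 163 (2006), Theorem 1 (arXiv:math/0404484
p. 2, held text chunk p0002 L33–L37): "Fix `∗ ∈ {alg, an}`. If `μ^∗(f₀) = 0` for some `f₀ ∈ H(ρ̄)`, then
`μ^∗(f) = 0` for all `f ∈ H(ρ̄)`", `H(ρ̄)` being "the set of all `p`-ordinary `p`-stabilized newforms `f`
with mod `p` Galois representation isomorphic to `ρ̄`" (p. 2, chunk p0002 L3–L13), which CONTAINS the
`p`-new weight-two newform of an elliptic curve multiplicative at `p` (Ex. 5.3.1, p. 32, chunk p0032: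
`X₀(11)` at `p = 11`, "`μ^an(f) = 0`" read on the Mazur–Tate–Teitelbaum function `L_p^an(f,T)`).
TRANSCRIPTION (`∗ = an`, module docstring): `W₁, W₂/ℚ` globally minimal, `5 ≤ p`, `W₁` GOOD ORDINARY at
`p` (`HasGoodReductionAtPrime`, `p ∤ a_p`), `W₂` MULTIPLICATIVE at `p`, a `Γ_ℚ`-equivariant additive
isomorphism `W₁[p] ≃ W₂[p]`, `W₁[p]` irreducible; HYPOTHESIS "`μ^an(f₁) = 0`" in the Néron shape of
`thm1_muAn_transfer_of_torsionIso` (some coefficient of `ϖ₁ · padicLFunction f₁ α` is a `p`-adic unit,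
for every newform `f₁` of `W₁` and every `ϖ₁` with `ϖ₁·Ω_{W₁} = Ω⁺_{f₁}`); CONCLUSION "`μ^an(f₂) = 0`"
in the shape of the BSD cell's `X11a.MuAnZeroAt W₂ p` (some coefficient of `ϖ₂·L` is a `p`-adic unit for
THE non-split function `IsMultPAdicLFunctionOf f₂ p (-1) L` at a non-split `p`, THE split one
`IsSplitMultPAdicLFunctionOf f₂ p L` at a split `p`; every newform `f₂` of `W₂`, every `ϖ₂` with
`ϖ₂·Ω_{W₂} = Ω⁺_{f₂}`). Canonical-vs-Néron period a `p`-adic unit under (irr) at odd `p` of good or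
multiplicative reduction: Greenberg–Vatsal 2000 §3 Prop. (3.1), Remark (3.4), Prop. (3.7); Skinner 2016
§3.3 — the bridge of the audited `cor514_transfer_of_goodOrdinary`. Weaker than print (two weight-two
members, `5 ≤ p`, `∗ = an`), never stronger. Named fact; nothing asserted; users take
`(h : thm1_muAn_transfer_mult_of_goodOrdinary)`.
-- TODO(general form): Theorem 1 for every pair of members of H(ρ̄) (all weights, twists ω^i), and ∗ = alg.
[cite: EmertonPollackWeston2006, Thm. 1 (arXiv:math/0404484 p. 2, held text `paper:arxiv-math_0404484` chunk p0002 L33–L37), Intro p. 2 (H(ρ̄), chunk p0002 L3–L13), §1 p. 5 (odd p), Prop. 4.1.4 (canonical periods), Ex. 5.3.1 (p. 32, chunk p0032 L20–L60: the p-new member X₀(11) at p = 11)]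
[cite: GreenbergVatsal2000, §3, Prop. (3.1), Remark (3.4), Prop. (3.7) (arXiv:math/9906215 pp. 34–39)]
[cite: Skinner2016PacificMC, §3.3 (arXiv:1407.1093 p0016 L14–L50)] -/
def thm1_muAn_transfer_mult_of_goodOrdinary : Prop :=
  ∀ (W₁ W₂ : WeierstrassCurve ℚ) [W₁.IsElliptic] [W₁.IsGloballyMinimal]
    [W₂.IsElliptic] [W₂.IsGloballyMinimal] (p : ℕ) [Fact p.Prime],
    5 ≤ p →
    W₁.HasGoodReductionAtPrime p → ¬ (p : ℤ) ∣ W₁.frobeniusTrace p →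
    W₂.HasMultiplicativeReductionAtPrime p →
    (∃ e : geomTorsion W₁ (p : ℤ) ≃+ geomTorsion W₂ (p : ℤ),
      ∀ (σ : Field.absoluteGaloisGroup ℚ) (P : geomTorsion W₁ (p : ℤ)), e (σ • P) = σ • e P) →
    W₁.HasIrreducibleModPGaloisRep p →
    (∀ [NeZero (W₁.conductorNorm ℤ)] (f₁ : CuspForm (Gamma0 (W₁.conductorNorm ℤ)) 2),
        IsNewformOf W₁ f₁ → ∀ (ϖ₁ : ℚ), (ϖ₁ : ℝ) * W₁.realPeriodRat = plusPeriod f₁ →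
      ∃ n : ℕ, ‖PowerSeries.coeff n
        (PowerSeries.C (ϖ₁ : ℚ_[p]) * padicLFunction f₁ (unitRoot W₁ p : ℚ_[p]))‖ = 1) →
    ∀ {N : ℕ} [NeZero N] (f₂ : CuspForm (Gamma0 N) 2), IsNewformOf W₂ f₂ →
      ∀ (ϖ₂ : ℚ), (ϖ₂ : ℝ) * W₂.realPeriodRat = plusPeriod f₂ →
        (¬ W₂.HasSplitMultiplicativeReductionAtPrime p →
          ∀ L : PowerSeries ℚ_[p], IsMultPAdicLFunctionOf f₂ p (-1) L →
            ∃ n : ℕ, ‖PowerSeries.coeff n (PowerSeries.C ((ϖ₂ : ℚ) : ℚ_[p]) * L)‖ = 1) ∧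
        (W₂.HasSplitMultiplicativeReductionAtPrime p →
          ∀ L : PowerSeries ℚ_[p], IsSplitMultPAdicLFunctionOf f₂ p L →
            ∃ n : ℕ, ‖PowerSeries.coeff n (PowerSeries.C ((ϖ₂ : ℚ) : ℚ_[p]) * L)‖ = 1)

/-- **Emerton–Pollack–Weston 2006, Theorem 1 (analytic half): between two mod-`p` congruent curves BOTH
MULTIPLICATIVE at `p`.** The same printed statement (Theorem 1, arXiv:math/0404484 p. 2, chunk p0002
L33–L37; `H(ρ̄)` p. 2; the `p`-new weight-two member, Ex. 5.3.1 p. 32), for two weight-two members BOTH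
with `p` in the level: `W₁, W₂/ℚ` globally minimal, `5 ≤ p`, `W₁` and `W₂` MULTIPLICATIVE at `p`, a
`Γ_ℚ`-equivariant additive isomorphism `W₁[p] ≃ W₂[p]`, `W₁[p]` irreducible (absolutely irreducible,
`p`-ordinary, `p`-distinguished: Tate curve, `ω ≠ 1`); HYPOTHESIS "`μ^an(f₁) = 0`" and CONCLUSION
"`μ^an(f₂) = 0`", both in the shape of the BSD cell's typed certificate `X11a.MuAnZeroAt` (module
docstring: some coefficient of the Néron-normalised Mazur–Tate–Teitelbaum series `ϖ·L` is a `p`-adic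
unit — THE non-split function at a non-split `p`, THE split one at a split `p`). Canonical vs Néron
period at `p ‖ N` under (irr): Greenberg–Vatsal 2000 §3 Prop. (3.1) ("all odd primes `p` of either good
or multiplicative reduction"), Prop. (3.7); Skinner 2016 §3.3 — the bridge of the audited
`cor514_transfer_of_multiplicative`. Weaker than print, never stronger. Named fact; nothing asserted;
users take `(h : thm1_muAn_transfer_mult_of_multiplicative)`.
-- TODO(general form): as above.
[cite: EmertonPollackWeston2006, Thm. 1 (arXiv:math/0404484 p. 2, chunk p0002 L33–L37), Intro p. 2 (H(ρ̄)), §1 p. 5, Prop. 4.1.4, Ex. 5.3.1 (p. 32)]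
[cite: GreenbergVatsal2000, §3, Prop. (3.1), Remark (3.4), Prop. (3.7) (arXiv:math/9906215 pp. 34–39)]
[cite: Skinner2016PacificMC, §3.3 (arXiv:1407.1093 p0016 L14–L50)] -/
def thm1_muAn_transfer_mult_of_multiplicative : Prop :=
  ∀ (W₁ W₂ : WeierstrassCurve ℚ) [W₁.IsElliptic] [W₁.IsGloballyMinimal]
    [W₂.IsElliptic] [W₂.IsGloballyMinimal] (p : ℕ) [Fact p.Prime],
    5 ≤ p →
    W₁.HasMultiplicativeReductionAtPrime p → W₂.HasMultiplicativeReductionAtPrime p →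
    (∃ e : geomTorsion W₁ (p : ℤ) ≃+ geomTorsion W₂ (p : ℤ),
      ∀ (σ : Field.absoluteGaloisGroup ℚ) (P : geomTorsion W₁ (p : ℤ)), e (σ • P) = σ • e P) →
    W₁.HasIrreducibleModPGaloisRep p →
    (∀ {N : ℕ} [NeZero N] (f₁ : CuspForm (Gamma0 N) 2), IsNewformOf W₁ f₁ →
      ∀ (ϖ₁ : ℚ), (ϖ₁ : ℝ) * W₁.realPeriodRat = plusPeriod f₁ →
        (¬ W₁.HasSplitMultiplicativeReductionAtPrime p →
          ∀ L : PowerSeries ℚ_[p], IsMultPAdicLFunctionOf f₁ p (-1) L →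
            ∃ n : ℕ, ‖PowerSeries.coeff n (PowerSeries.C ((ϖ₁ : ℚ) : ℚ_[p]) * L)‖ = 1) ∧
        (W₁.HasSplitMultiplicativeReductionAtPrime p →
          ∀ L : PowerSeries ℚ_[p], IsSplitMultPAdicLFunctionOf f₁ p L →
            ∃ n : ℕ, ‖PowerSeries.coeff n (PowerSeries.C ((ϖ₁ : ℚ) : ℚ_[p]) * L)‖ = 1)) →
    ∀ {N : ℕ} [NeZero N] (f₂ : CuspForm (Gamma0 N) 2), IsNewformOf W₂ f₂ →
      ∀ (ϖ₂ : ℚ), (ϖ₂ : ℝ) * W₂.realPeriodRat = plusPeriod f₂ →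
        (¬ W₂.HasSplitMultiplicativeReductionAtPrime p →
          ∀ L : PowerSeries ℚ_[p], IsMultPAdicLFunctionOf f₂ p (-1) L →
            ∃ n : ℕ, ‖PowerSeries.coeff n (PowerSeries.C ((ϖ₂ : ℚ) : ℚ_[p]) * L)‖ = 1) ∧
        (W₂.HasSplitMultiplicativeReductionAtPrime p →
          ∀ L : PowerSeries ℚ_[p], IsSplitMultPAdicLFunctionOf f₂ p L →
            ∃ n : ℕ, ‖PowerSeries.coeff n (PowerSeries.C ((ϖ₂ : ℚ) : ℚ_[p]) * L)‖ = 1)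

end Literature.NumberTheory.EllipticCurves.EmertonPollackWeston2006

end
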